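import Summits.ResolutionOfSingularities.ResolutionOfSingularities.Theorems.FrobeniusClosingPatchingRelPerfectDepthTargetsWeightedDefs
import Summits.ResolutionOfSingularities.ResolutionOfSingularities.Theorems.FrobeniusClosingPatchingRelPerfectDepthOnePrincipalizeControlled
import Literature.AlgebraicGeometry.Resolution.Principalization
import Literature.AlgebraicGeometry.Resolution.BlowupsIntegral
import HarnessLib

/-!
# Crux `PatchingRelPerfect` (stmt-ResolutionOfSingularities-16161), chain w52 — R4 support:
# S-W «WEIGHTED-SEQ TRANSPORT» (TargetsF2 STEER (f))

[OURS · L1 W5.2 · rung tool] res-L1-w52-plan-1 g6 STEER 2026-08-27T05:26:19Z (f) / ACK 05:46:13Z (object of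
res-D-pv-009): the bookkeeping of the E-side weighted sequences `DepthTargets.IsWeightedSeq μ` /
`DepthTargets.IsPureWeightedSeq μ` of TargetsF2 (p502025, `…DepthTargetsWeightedDefs.lean`), consumed by W₂
`WeightTwoPrincipal₃` (Phase A ++ Phase B) and by the X-side towers:
* §1 concatenation — `IsWeightedSeq.append`, `IsWeightedSeq.single`, `IsWeightedSeq.append_pure` (a weighted
  sequence followed by a pure weight-`μ` one, `1 ≤ μ`; the pure/pure case is `DepthCleanup.pureWeightedSeq_append`,
  p502656-series of res-D-pv-054);
* §2 the bridges at weight one — `IsWeightedSeq.of_isControlledSeq`, `IsWeightedSeq.isControlledSeq`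
  (`IsWeightedSeq 1 = DepthOneTargets.IsControlledSeq` up to `pow_one`), `IsPureWeightedSeq.of_isControlledSeq`,
  `IsPureWeightedSeq.isControlledSeq` — so that Θ₃ `ControlledTrivialization₃` feeds weight-one consumers;
* §3 ONE weighted step on an integral Noetherian regular scheme — `weightedStep_transport`: for `𝔟 ≠ ⊥`,
  `𝔟 ≤ C^ν` (`1 ≤ ν`), `V(C)` regular, `τ` the blowing up along `C` and `𝔟𝒪 = (C𝒪)^ν · 𝔟'`: `E'` is integral,
  Noetherian, regular; `𝔟' ≠ ⊥`; `Supp 𝔟' ⊆ τ⁻¹ Supp 𝔟` (= strict transform ∪ exceptional divisor, as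
  `V(C) ⊆ Supp 𝔟`); `𝔟` locally principal ⇒ `𝔟'` locally principal; `E` excellent ⇒ `E'` excellent;
  `dim E = n ⇒ dim E' = n`; `τ` surjective; `weightedStep_controlledTransform` (the same with
  `𝔟' := controlledTransform τ C 𝔟 ν` and its FORMAT) and `IsWeightedSeq.snoc_controlledTransform` (extend a sequence by it);
* §4 the same ALONG A WEIGHTED SEQUENCE — `IsWeightedSeq.transport` and its projections
  (`IsWeightedSeq.isIntegral`, `.isNoetherian'`, `.isRegular`, `.ne_bot`, `.support_subset`, `.isLocallyPrincipal`,
  `.isExcellent`, `.topologicalKrullDim_eq`, `.surjective`).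
Per-step tools (all in tree): `IsBlowup.isIntegral` (BlowupsIntegral), `IsBlowup.isRegular_of_isRegular_subscheme`
(Liu 8.1.19 (a)), `IsBlowup.comap_ne_bot` (RegularCentreBlowupSeqIntegral), `IsLocallyPrincipal.isEffectiveCartier_of_ne_bot`
/ `IsEffectiveCartier.comap_of_isBlowup` / `.of_mul_right` / `.isLocallyPrincipal`,
`Scheme.IsExcellent.of_locallyOfFiniteType` (Matsumura §32), `DepthOne.topologicalKrullDim_eq_of_isBlowup`,
`DepthOne.surjective_of_isBlowup` (res-type-003, p496767). Fact-free. Nothing here is a statement of the manuscript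
under review.

## References
* E. Bierstone, D. Grigoriev, P. Milman, J. Włodarczyk (2011), Def. 3.1.3, §3.2 Lemma 3.2.1.
  [BierstoneGrigorievMilmanWlodarczyk2011]
* J. Kollár, *Lectures on Resolution of Singularities* (2007), 3.30.2, (3.111) Step 3. [Kollar2007]
* Q. Liu, *Algebraic Geometry and Arithmetic Curves* (2002), Thm. 8.1.19 (a). [Liu2002]
* H. Matsumura, *Commutative Ring Theory* (1986), §32 p. 260. [Matsumura1987]
* The Stacks Project, Tag 02OS. [StacksProject]
-/

-- `Summit.<Summit>.<Sub>.Theorems` with `Sub = Summit` (single-conjunct summit, D-0017)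
set_option linter.dupNamespace false

noncomputable section

open CategoryTheory CategoryTheory.Limits AlgebraicGeometry TopologicalSpace
open Literature.AlgebraicGeometry.Resolution

namespace Summit.ResolutionOfSingularities.ResolutionOfSingularities.Theorems.DepthTargets

universe u

open DepthOneTargets

/-! ## §1 Concatenation -/

/-- **Concatenation of weighted sequences**: a weighted sequence (weights `≤ μ`) on `E'` starting from the end
ideal of a weighted sequence `E' → E` extends it. [folklore] -/
theorem IsWeightedSeq.append {μ : ℕ} {E'' E' E : Scheme.{u}} {ρ : E' ⟶ E} {ρ' : E'' ⟶ E'}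
    {𝔟 : E.IdealSheafData} {𝔟' : E'.IdealSheafData} {𝔟'' : E''.IdealSheafData}
    (h' : IsWeightedSeq μ ρ' 𝔟' 𝔟'') :
    IsWeightedSeq μ ρ 𝔟 𝔟' → IsWeightedSeq μ (ρ' ≫ ρ) 𝔟 𝔟'' := by
  induction h' with
  | nil 𝔟₀ =>
      intro h
      simpa only [Category.id_comp] using h
  | cons τ ρ₀ 𝔟₀ 𝔟₁ 𝔟₂ C ν hseq hC h1 hν hle hτ hctrl ih =>
      intro h
      rw [Category.assoc]
      exact IsWeightedSeq.cons τ (ρ₀ ≫ ρ) 𝔟 𝔟₁ 𝔟₂ C ν (ih h) hC h1 hν hle hτ hctrl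

/-- A single blowing up permissible with weight `ν`, `1 ≤ ν ≤ μ`, is a weighted sequence of length one. [folklore] -/
theorem IsWeightedSeq.single {μ ν : ℕ} {E' E : Scheme.{u}} (τ : E' ⟶ E) (𝔟 : E.IdealSheafData)
    (𝔟' : E'.IdealSheafData) (C : E.IdealSheafData) (hC : Scheme.IsRegular C.subscheme) (h1 : 1 ≤ ν)
    (hν : ν ≤ μ) (hle : 𝔟 ≤ C ^ ν) (hτ : IsBlowup τ C) (hctrl : 𝔟.comap τ = C.comap τ ^ ν * 𝔟') :
    IsWeightedSeq μ τ 𝔟 𝔟' := by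
  have h := IsWeightedSeq.cons τ (𝟙 E) 𝔟 𝔟 𝔟' C ν (IsWeightedSeq.nil 𝔟) hC h1 hν hle hτ hctrl
  simpa only [Category.comp_id] using h

/-- **A weighted sequence followed by a PURE weight-`μ` sequence** (`1 ≤ μ`) is a weighted sequence with weights
`≤ μ` — the shape of W₂ `WeightTwoPrincipal₃` (Phase A weighted, Phase B `WeightedCleanupSNC μ`). [folklore] -/
theorem IsWeightedSeq.append_pure {μ : ℕ} (hμ : 1 ≤ μ) {E'' E' E : Scheme.{u}} {ρ : E' ⟶ E} {ρ' : E'' ⟶ E'}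
    {𝔟 : E.IdealSheafData} {𝔟' : E'.IdealSheafData} {𝔟'' : E''.IdealSheafData}
    (h' : IsPureWeightedSeq μ ρ' 𝔟' 𝔟'') (h : IsWeightedSeq μ ρ 𝔟 𝔟') :
    IsWeightedSeq μ (ρ' ≫ ρ) 𝔟 𝔟'' :=
  (h'.isWeightedSeq hμ).append h

/-! ## §2 The bridges at weight one -/

/-- A controlled sequence (`DepthOneTargets.IsControlledSeq`: weight-one steps) is a weighted sequence with
weights `≤ 1`. [folklore] -/
theorem IsWeightedSeq.of_isControlledSeq :
    ∀ {E' E : Scheme.{u}} {ρ : E' ⟶ E} {𝔟 : E.IdealSheafData} {𝔟' : E'.IdealSheafData},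
      IsControlledSeq ρ 𝔟 𝔟' → IsWeightedSeq 1 ρ 𝔟 𝔟'
  | _, _, _, _, _, .nil 𝔟 => .nil 𝔟
  | _, _, _, _, _, .cons τ ρ 𝔟 𝔟' 𝔟'' C h hC hle hτ heq =>
    .cons τ ρ 𝔟 𝔟' 𝔟'' C 1 (IsWeightedSeq.of_isControlledSeq h) hC le_rfl le_rfl
      (by rwa [pow_one]) hτ (by rwa [pow_one])

/-- A weighted sequence with weights `≤ 1` is a controlled sequence. [folklore] -/
theorem IsWeightedSeq.isControlledSeq :
    ∀ {E' E : Scheme.{u}} {ρ : E' ⟶ E} {𝔟 : E.IdealSheafData} {𝔟' : E'.IdealSheafData},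
      IsWeightedSeq 1 ρ 𝔟 𝔟' → IsControlledSeq ρ 𝔟 𝔟'
  | _, _, _, _, _, .nil 𝔟 => .nil 𝔟
  | _, _, _, _, _, .cons τ ρ 𝔟 𝔟' 𝔟'' C ν h hC h1 hν hle hτ heq => by
    obtain rfl : ν = 1 := le_antisymm hν h1
    exact .cons τ ρ 𝔟 𝔟' 𝔟'' C (IsWeightedSeq.isControlledSeq h) hC (by rwa [pow_one] at hle) hτ
      (by rwa [pow_one] at heq)

/-- A controlled sequence is a pure weight-one sequence. [folklore] -/
theorem IsPureWeightedSeq.of_isControlledSeq :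
    ∀ {E' E : Scheme.{u}} {ρ : E' ⟶ E} {𝔟 : E.IdealSheafData} {𝔟' : E'.IdealSheafData},
      IsControlledSeq ρ 𝔟 𝔟' → IsPureWeightedSeq 1 ρ 𝔟 𝔟'
  | _, _, _, _, _, .nil 𝔟 => .nil 𝔟
  | _, _, _, _, _, .cons τ ρ 𝔟 𝔟' 𝔟'' C h hC hle hτ heq =>
    .cons τ ρ 𝔟 𝔟' 𝔟'' C (IsPureWeightedSeq.of_isControlledSeq h) hC (by rwa [pow_one]) hτ
      (by rwa [pow_one])

/-- A pure weight-one sequence is a controlled sequence. [folklore] -/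
theorem IsPureWeightedSeq.isControlledSeq :
    ∀ {E' E : Scheme.{u}} {ρ : E' ⟶ E} {𝔟 : E.IdealSheafData} {𝔟' : E'.IdealSheafData},
      IsPureWeightedSeq 1 ρ 𝔟 𝔟' → IsControlledSeq ρ 𝔟 𝔟'
  | _, _, _, _, _, .nil 𝔟 => .nil 𝔟
  | _, _, _, _, _, .cons τ ρ 𝔟 𝔟' 𝔟'' C h hC hle hτ heq =>
    .cons τ ρ 𝔟 𝔟' 𝔟'' C (IsPureWeightedSeq.isControlledSeq h) hC (by rwa [pow_one] at hle) hτ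
      (by rwa [pow_one] at heq)

/-! ## §3 One weighted step on an integral Noetherian regular scheme -/

/-- **One weighted step.** On an integral Noetherian regular scheme `E`, let `𝔟 ≠ ⊥`, `𝔟 ≤ C^ν` with `1 ≤ ν` and
`V(C)` regular, `τ : E' ⟶ E` a blowing up along `C` and `𝔟𝒪_{E'} = (C𝒪_{E'})^ν · 𝔟'`. Then: `C ≠ ⊥`, so `E'` is
integral (`IsBlowup.isIntegral`) and `dim E' = dim E`, `τ` surjective (res-type-003's `DepthOne.*`); `E'` is
Noetherian (properness) and regular (Liu 8.1.19 (a)); `𝔟𝒪_{E'} ≠ ⊥` (`IsBlowup.comap_ne_bot`), hence `𝔟' ≠ ⊥`;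
`Supp 𝔟' ⊆ Supp 𝔟𝒪 = τ⁻¹ Supp 𝔟`; if `𝔟` is locally principal it is an effective Cartier divisor
(`IsLocallyPrincipal.isEffectiveCartier_of_ne_bot`), so is `𝔟𝒪 = (C𝒪)^ν · 𝔟'`, hence `𝔟'` (cancel); excellence by
Matsumura §32 (`Scheme.IsExcellent.of_locallyOfFiniteType`). [cite: Liu2002, Thm. 8.1.19 (a)]
[cite: Matsumura1987, §32 p. 260] [cite: StacksProject, Tag 02OS] [cite: BierstoneGrigorievMilmanWlodarczyk2011, §3.2 Lemma 3.2.1] -/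
theorem weightedStep_transport {E' E : Scheme.{u}} [IsIntegral E] [IsNoetherian E] (hE : Scheme.IsRegular E)
    {𝔟 : E.IdealSheafData} (h𝔟 : 𝔟 ≠ ⊥) {C : E.IdealSheafData} {ν : ℕ} (h1 : 1 ≤ ν)
    (hC : Scheme.IsRegular C.subscheme) (hle : 𝔟 ≤ C ^ ν) {τ : E' ⟶ E} (hτ : IsBlowup τ C)
    {𝔟' : E'.IdealSheafData} (hctrl : 𝔟.comap τ = C.comap τ ^ ν * 𝔟') :
    (IsIntegral E' ∧ IsNoetherian E' ∧ Scheme.IsRegular E' ∧ 𝔟' ≠ ⊥ ∧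
      (𝔟'.support : Set E') ⊆ τ.base ⁻¹' (𝔟.support : Set E) ∧
      (IsLocallyPrincipal 𝔟 → IsLocallyPrincipal 𝔟') ∧
      (Scheme.IsExcellent E → Scheme.IsExcellent E') ∧
      (∀ n : ℕ, topologicalKrullDim E = n → topologicalKrullDim E' = n) ∧
      Function.Surjective τ.base) := by
  -- the centre is non-zero
  have hCne : C ≠ ⊥ := by
    intro hC0
    apply h𝔟
    rw [hC0, ← Scheme.IdealSheafData.zero_eq_bot, zero_pow (by omega)] at hle
    exact le_bot_iff.mp (hle.trans_eq (Scheme.IdealSheafData.zero_eq_bot))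
  have hCsupp : C.support ≠ ⊤ := fun h => hCne (Scheme.IdealSheafData.support_eq_top_iff.mp h)
  -- `E'` integral, Noetherian, regular
  haveI : IsIntegral E' := hτ.isIntegral hCne
  haveI : IsProper τ := hτ.isProper
  haveI : IsLocallyNoetherian E' := LocallyOfFiniteType.isLocallyNoetherian τ
  haveI : CompactSpace E' := QuasiCompact.compactSpace_of_compactSpace τ
  have hE'N : IsNoetherian E' := {}
  have hE'reg : Scheme.IsRegular E' := hτ.isRegular_of_isRegular_subscheme hE hC
  -- `𝔟𝒪 ≠ ⊥`, `𝔟' ≠ ⊥`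
  have hcomap : 𝔟.comap τ ≠ ⊥ := hτ.comap_ne_bot hCsupp h𝔟
  have hne : 𝔟' ≠ ⊥ := by
    intro h0
    apply hcomap
    rw [hctrl, h0, Scheme.IdealSheafData.mul_bot]
  -- `𝔟𝒪 ≤ 𝔟'`
  have hle' : 𝔟.comap τ ≤ 𝔟' := by
    rw [hctrl]
    exact mul_le_of_le_one_left bot_le le_top
  refine ⟨inferInstance, hE'N, hE'reg, hne, ?_, ?_, ?_, ?_, DepthOne.surjective_of_isBlowup hτ hCne⟩
  · -- support
    intro x hx
    have h := Scheme.IdealSheafData.support_antitone hle' hx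
    rwa [Scheme.IdealSheafData.support_comap] at h
  · -- local principality via effective Cartier divisors
    intro hlp
    have h𝔟c : IsEffectiveCartier 𝔟 := hlp.isEffectiveCartier_of_ne_bot h𝔟
    have h := h𝔟c.comap_of_isBlowup hτ
    rw [hctrl] at h
    exact h.of_mul_right.isLocallyPrincipal
  · -- excellence
    intro hexc
    exact Scheme.IsExcellent.of_locallyOfFiniteType τ hexc
  · -- dimension
    intro n hn
    exact DepthOne.topologicalKrullDim_eq_of_isBlowup hτ hCne hn

/-- **One weighted step with the controlled transform as the new ideal** (the form W₂ Phase A consumes): under the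
hypotheses of `weightedStep_transport` minus `hctrl`, the weight-`ν` controlled transform
`𝔟' := controlledTransform τ C 𝔟 ν` satisfies the FORMAT `𝔟𝒪_{E'} = (C𝒪_{E'})^ν · 𝔟'` (BGMW Lemma 3.2.1 with exponent
`ν`, `IsBlowup.pow_mul_controlledTransform_eq`) and the nine permanence conjuncts.
[cite: BierstoneGrigorievMilmanWlodarczyk2011, §3.2 Lemma 3.2.1] [cite: Liu2002, Thm. 8.1.19 (a)] -/
theorem weightedStep_controlledTransform {E' E : Scheme.{u}} [IsIntegral E] [IsNoetherian E]
    (hE : Scheme.IsRegular E) {𝔟 : E.IdealSheafData} (h𝔟 : 𝔟 ≠ ⊥) {C : E.IdealSheafData} {ν : ℕ} (h1 : 1 ≤ ν)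
    (hC : Scheme.IsRegular C.subscheme) (hle : 𝔟 ≤ C ^ ν) {τ : E' ⟶ E} (hτ : IsBlowup τ C) :
    𝔟.comap τ = C.comap τ ^ ν * controlledTransform τ C 𝔟 ν ∧
    (IsIntegral E' ∧ IsNoetherian E' ∧ Scheme.IsRegular E' ∧ controlledTransform τ C 𝔟 ν ≠ ⊥ ∧
      ((controlledTransform τ C 𝔟 ν).support : Set E') ⊆ τ.base ⁻¹' (𝔟.support : Set E) ∧
      (IsLocallyPrincipal 𝔟 → IsLocallyPrincipal (controlledTransform τ C 𝔟 ν)) ∧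
      (Scheme.IsExcellent E → Scheme.IsExcellent E') ∧
      (∀ n : ℕ, topologicalKrullDim E = n → topologicalKrullDim E' = n) ∧
      Function.Surjective τ.base) := by
  have hle' : 𝔟.comap τ ≤ C.comap τ ^ ν := by
    rw [← comap_pow]; exact Scheme.IdealSheafData.comap_mono (f := τ) hle
  have hctrl : 𝔟.comap τ = C.comap τ ^ ν * controlledTransform τ C 𝔟 ν :=
    (hτ.pow_mul_controlledTransform_eq hle').symm
  exact ⟨hctrl, weightedStep_transport hE h𝔟 h1 hC hle hτ hctrl⟩

/-- **Extending a weighted sequence by one controlled step** (`snoc` with the controlled transform): if `ρ : E' ⟶ E`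
is a weighted sequence (weights `≤ μ`) carrying `𝔟` to `𝔟'` and `τ : E'' ⟶ E'` blows up a centre `C` with `V(C)`
regular and `𝔟' ≤ C^ν`, `1 ≤ ν ≤ μ`, then `τ ≫ ρ` is a weighted sequence carrying `𝔟` to `controlledTransform τ C 𝔟' ν`.
[cite: BierstoneGrigorievMilmanWlodarczyk2011, Def. 3.1.3, §3.2 Lemma 3.2.1] -/
theorem IsWeightedSeq.snoc_controlledTransform {μ ν : ℕ} {E'' E' E : Scheme.{u}} {ρ : E' ⟶ E}
    {𝔟 : E.IdealSheafData} {𝔟' : E'.IdealSheafData} (h : IsWeightedSeq μ ρ 𝔟 𝔟') {C : E'.IdealSheafData}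
    (hC : Scheme.IsRegular C.subscheme) (h1 : 1 ≤ ν) (hν : ν ≤ μ) (hle : 𝔟' ≤ C ^ ν) {τ : E'' ⟶ E'}
    (hτ : IsBlowup τ C) : IsWeightedSeq μ (τ ≫ ρ) 𝔟 (controlledTransform τ C 𝔟' ν) := by
  have hle' : 𝔟'.comap τ ≤ C.comap τ ^ ν := by
    rw [← comap_pow]; exact Scheme.IdealSheafData.comap_mono (f := τ) hle
  exact IsWeightedSeq.cons τ ρ 𝔟 𝔟' _ C ν h hC h1 hν hle hτ (hτ.pow_mul_controlledTransform_eq hle').symm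

/-! ## §4 Along a weighted sequence -/

/-- **Transport along a weighted sequence.** On an integral Noetherian regular scheme `E` with `𝔟 ≠ ⊥`, every
weighted sequence `ρ : E' ⟶ E` (any weight bound `μ`; all weights are `≥ 1`) carrying `𝔟` to `𝔟'` satisfies: `E'` integral, Noetherian, regular; `𝔟' ≠ ⊥`; `Supp 𝔟' ⊆ ρ⁻¹ Supp 𝔟`; `𝔟` locally principal
⇒ `𝔟'` locally principal; `E` excellent ⇒ `E'` excellent; `dim E = n ⇒ dim E' = n`; `ρ` surjective. Induction on
the sequence with `weightedStep_transport`. [cite: Liu2002, Thm. 8.1.19 (a)] [cite: Matsumura1987, §32 p. 260]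
[cite: Kollar2007, 3.30.2] -/
theorem IsWeightedSeq.transport {μ : ℕ} {E' E : Scheme.{u}} {ρ : E' ⟶ E} {𝔟 : E.IdealSheafData}
    {𝔟' : E'.IdealSheafData} (h : IsWeightedSeq μ ρ 𝔟 𝔟') :
    ∀ [IsIntegral E] [IsNoetherian E], Scheme.IsRegular E → 𝔟 ≠ ⊥ →
    (IsIntegral E' ∧ IsNoetherian E' ∧ Scheme.IsRegular E' ∧ 𝔟' ≠ ⊥ ∧
      (𝔟'.support : Set E') ⊆ ρ.base ⁻¹' (𝔟.support : Set E) ∧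
      (IsLocallyPrincipal 𝔟 → IsLocallyPrincipal 𝔟') ∧
      (Scheme.IsExcellent E → Scheme.IsExcellent E') ∧
      (∀ n : ℕ, topologicalKrullDim E = n → topologicalKrullDim E' = n) ∧
      Function.Surjective ρ.base) := by
  induction h with
  | nil 𝔟₀ =>
      intro _ _ hE h𝔟
      exact ⟨inferInstance, inferInstance, hE, h𝔟, fun x hx => by simpa using hx, id, id, fun _ h => h,
        fun x => ⟨x, rfl⟩⟩
  | cons τ ρ₀ 𝔟₀ 𝔟₁ 𝔟₂ C ν hseq hC h1 hν hle hτ hctrl ih =>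
      intro _ _ hE h𝔟
      obtain ⟨hint, hnoeth, hreg, hne, hsupp, hlp, hexc, hdim, hsurj⟩ := ih hE h𝔟
      haveI := hint
      haveI := hnoeth
      obtain ⟨hint', hnoeth', hreg', hne', hsupp', hlp', hexc', hdim', hsurj'⟩ :=
        weightedStep_transport hreg hne h1 hC hle hτ hctrl
      refine ⟨hint', hnoeth', hreg', hne', ?_, fun hl => hlp' (hlp hl), fun he => hexc' (hexc he),
        fun n hn => hdim' n (hdim n hn), ?_⟩
      · intro x hx
        have hx' := hsupp' hx
        simp only [Set.mem_preimage, Scheme.Hom.comp_base, TopCat.coe_comp, Function.comp_apply] at hx' ⊢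
        exact hsupp hx'
      · simp only [Scheme.Hom.comp_base, TopCat.coe_comp]
        exact hsurj.comp hsurj'

/-- Along a weighted sequence from an integral Noetherian regular `E` with `𝔟 ≠ ⊥`: the top is integral. -/
theorem IsWeightedSeq.isIntegral {μ : ℕ} {E' E : Scheme.{u}} {ρ : E' ⟶ E} {𝔟 : E.IdealSheafData}
    {𝔟' : E'.IdealSheafData} (h : IsWeightedSeq μ ρ 𝔟 𝔟') [IsIntegral E] [IsNoetherian E]
    (hE : Scheme.IsRegular E) (h𝔟 : 𝔟 ≠ ⊥) : IsIntegral E' :=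
  (h.transport hE h𝔟).1

/-- … the top is Noetherian. -/
theorem IsWeightedSeq.isNoetherian' {μ : ℕ} {E' E : Scheme.{u}} {ρ : E' ⟶ E} {𝔟 : E.IdealSheafData}
    {𝔟' : E'.IdealSheafData} (h : IsWeightedSeq μ ρ 𝔟 𝔟') [IsIntegral E] [IsNoetherian E]
    (hE : Scheme.IsRegular E) (h𝔟 : 𝔟 ≠ ⊥) : IsNoetherian E' :=
  (h.transport hE h𝔟).2.1

/-- … the top is regular. [cite: Liu2002, Thm. 8.1.19 (a)] -/
theorem IsWeightedSeq.isRegular {μ : ℕ} {E' E : Scheme.{u}} {ρ : E' ⟶ E} {𝔟 : E.IdealSheafData}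
    {𝔟' : E'.IdealSheafData} (h : IsWeightedSeq μ ρ 𝔟 𝔟') [IsIntegral E] [IsNoetherian E]
    (hE : Scheme.IsRegular E) (h𝔟 : 𝔟 ≠ ⊥) : Scheme.IsRegular E' :=
  (h.transport hE h𝔟).2.2.1

/-- … the end ideal is non-zero. [cite: StacksProject, Tag 02OS] -/
theorem IsWeightedSeq.ne_bot {μ : ℕ} {E' E : Scheme.{u}} {ρ : E' ⟶ E} {𝔟 : E.IdealSheafData}
    {𝔟' : E'.IdealSheafData} (h : IsWeightedSeq μ ρ 𝔟 𝔟') [IsIntegral E] [IsNoetherian E]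
    (hE : Scheme.IsRegular E) (h𝔟 : 𝔟 ≠ ⊥) : 𝔟' ≠ ⊥ :=
  (h.transport hE h𝔟).2.2.2.1

/-- … the support of the end ideal lies over the support of `𝔟` (total transform).
[cite: BierstoneGrigorievMilmanWlodarczyk2011, §3.2 Lemma 3.2.1] -/
theorem IsWeightedSeq.support_subset {μ : ℕ} {E' E : Scheme.{u}} {ρ : E' ⟶ E} {𝔟 : E.IdealSheafData}
    {𝔟' : E'.IdealSheafData} (h : IsWeightedSeq μ ρ 𝔟 𝔟') [IsIntegral E] [IsNoetherian E]
    (hE : Scheme.IsRegular E) (h𝔟 : 𝔟 ≠ ⊥) :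
    (𝔟'.support : Set E') ⊆ ρ.base ⁻¹' (𝔟.support : Set E) :=
  (h.transport hE h𝔟).2.2.2.2.1

/-- … local principality is preserved (each step: effective Cartier divisors pull back and cancel). -/
theorem IsWeightedSeq.isLocallyPrincipal {μ : ℕ} {E' E : Scheme.{u}} {ρ : E' ⟶ E} {𝔟 : E.IdealSheafData}
    {𝔟' : E'.IdealSheafData} (h : IsWeightedSeq μ ρ 𝔟 𝔟') [IsIntegral E] [IsNoetherian E]
    (hE : Scheme.IsRegular E) (h𝔟 : 𝔟 ≠ ⊥) (hlp : IsLocallyPrincipal 𝔟) : IsLocallyPrincipal 𝔟' :=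
  (h.transport hE h𝔟).2.2.2.2.2.1 hlp

/-- … excellence is preserved. [cite: Matsumura1987, §32 p. 260] -/
theorem IsWeightedSeq.isExcellent {μ : ℕ} {E' E : Scheme.{u}} {ρ : E' ⟶ E} {𝔟 : E.IdealSheafData}
    {𝔟' : E'.IdealSheafData} (h : IsWeightedSeq μ ρ 𝔟 𝔟') [IsIntegral E] [IsNoetherian E]
    (hE : Scheme.IsRegular E) (h𝔟 : 𝔟 ≠ ⊥) (hexc : Scheme.IsExcellent E) : Scheme.IsExcellent E' :=
  (h.transport hE h𝔟).2.2.2.2.2.2.1 hexc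

/-- … the dimension is preserved. [folklore] -/
theorem IsWeightedSeq.topologicalKrullDim_eq {μ : ℕ} {E' E : Scheme.{u}} {ρ : E' ⟶ E} {𝔟 : E.IdealSheafData}
    {𝔟' : E'.IdealSheafData} (h : IsWeightedSeq μ ρ 𝔟 𝔟') [IsIntegral E] [IsNoetherian E]
    (hE : Scheme.IsRegular E) (h𝔟 : 𝔟 ≠ ⊥) {n : ℕ} (hn : topologicalKrullDim E = n) :
    topologicalKrullDim E' = n :=
  (h.transport hE h𝔟).2.2.2.2.2.2.2.1 n hn

/-- … the composite blowing up is surjective. [folklore] -/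
theorem IsWeightedSeq.surjective {μ : ℕ} {E' E : Scheme.{u}} {ρ : E' ⟶ E} {𝔟 : E.IdealSheafData}
    {𝔟' : E'.IdealSheafData} (h : IsWeightedSeq μ ρ 𝔟 𝔟') [IsIntegral E] [IsNoetherian E]
    (hE : Scheme.IsRegular E) (h𝔟 : 𝔟 ≠ ⊥) : Function.Surjective ρ.base :=
  (h.transport hE h𝔟).2.2.2.2.2.2.2.2

/-- The same transport along a PURE weight-`μ` sequence, `1 ≤ μ`. [folklore] -/
theorem IsPureWeightedSeq.transport {μ : ℕ} (hμ : 1 ≤ μ) {E' E : Scheme.{u}} {ρ : E' ⟶ E}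
    {𝔟 : E.IdealSheafData} {𝔟' : E'.IdealSheafData} (h : IsPureWeightedSeq μ ρ 𝔟 𝔟') [IsIntegral E]
    [IsNoetherian E] (hE : Scheme.IsRegular E) (h𝔟 : 𝔟 ≠ ⊥) :
    (IsIntegral E' ∧ IsNoetherian E' ∧ Scheme.IsRegular E' ∧ 𝔟' ≠ ⊥ ∧
      (𝔟'.support : Set E') ⊆ ρ.base ⁻¹' (𝔟.support : Set E) ∧
      (IsLocallyPrincipal 𝔟 → IsLocallyPrincipal 𝔟') ∧
      (Scheme.IsExcellent E → Scheme.IsExcellent E') ∧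
      (∀ n : ℕ, topologicalKrullDim E = n → topologicalKrullDim E' = n) ∧
      Function.Surjective ρ.base) :=
  (h.isWeightedSeq hμ).transport hE h𝔟

/-- The same transport along a controlled (weight-one) sequence (e.g. Θ₃'s). [folklore] -/
theorem transport_of_isControlledSeq {E' E : Scheme.{u}} {ρ : E' ⟶ E} {𝔟 : E.IdealSheafData}
    {𝔟' : E'.IdealSheafData} (h : IsControlledSeq ρ 𝔟 𝔟') [IsIntegral E] [IsNoetherian E]
    (hE : Scheme.IsRegular E) (h𝔟 : 𝔟 ≠ ⊥) :
    (IsIntegral E' ∧ IsNoetherian E' ∧ Scheme.IsRegular E' ∧ 𝔟' ≠ ⊥ ∧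
      (𝔟'.support : Set E') ⊆ ρ.base ⁻¹' (𝔟.support : Set E) ∧
      (IsLocallyPrincipal 𝔟 → IsLocallyPrincipal 𝔟') ∧
      (Scheme.IsExcellent E → Scheme.IsExcellent E') ∧
      (∀ n : ℕ, topologicalKrullDim E = n → topologicalKrullDim E' = n) ∧
      Function.Surjective ρ.base) :=
  (IsWeightedSeq.of_isControlledSeq h).transport hE h𝔟

end Summit.ResolutionOfSingularities.ResolutionOfSingularities.Theorems.DepthTargets

end
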